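import Mathlib.RingTheory.AdicCompletion.Basic
import Mathlib.RingTheory.Ideal.Operations
import Mathlib.Tactic.LinearCombination
import Mathlib.Tactic.Ring
import HarnessLib

/-!
# A two-generator completeness criterion: `(p, t)`-adic completeness from `p`-adic completeness of `A`
# and `t`-adic completeness of `A/p`

Topic `Literature/RingTheory/AdicTopology`; THEOREMS ONLY (no definition, no named fact, no instance,
no `sorry`). Pure commutative algebra, written for Fontaine's ring `𝔸_inf = 𝕎(𝒪_{ℂ_F}♭)` (sequel
`Literature/NumberTheory/PAdicHodge/AinfAdicComplete.lean`: `𝔸_inf` is `(p, ξ)`-adically complete), but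
stated for an arbitrary commutative ring `A` and elements `p t : A`:

**`AdicPair.isAdicComplete`** — `IsAdicComplete (span {p, t}) A` follows from
(i) `IsAdicComplete (span {p}) A`; (ii) `p` is a non-zero-divisor of `A`; (iii) `t` is a non-zero-divisor
modulo `p` (`t x ∈ (p) ⇒ x ∈ (p)`); (iv) `A/p` is `t`-adically separated and (v) `t`-adically complete —
(iv)/(v) phrased inside `A` modulo `span {p}` (so that no quotient ring appears):
`hH : (∀ n, x ∈ (tⁿ) + (p)) → x ∈ (p)` and
`hC : (∀ n, f(n+1) − f(n) ∈ (t^{n+1}) + (p)) → ∃ l, ∀ n, l − f(n) ∈ (t^{n+1}) + (p)`.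

Tools: the filtration identity `(p,t)^{n+1} ⊆ p·(p,t)^n + t^{n+1}A` (`pow_succ_le`); the division lemma
`p y ∈ (p,t)^{n+1} ⇒ y ∈ (p,t)^n` (`mem_pow_of_mul_mem_pow_succ`); separatedness by peeling off powers of
`p` (`isHausdorff`: `⋂ (p,t)ⁿ ⊆ ⋂ (p^k)`); completeness (`isPrecomplete`) by the iteration
`f(n) = λ₀ + t^{n+1}c_n + p f₁(n)` (`exists_peel`: `λ₀` = the `t`-adic limit mod `p`, `f₁` again Cauchy by the
division lemma), `f(n+J) = Σ_{j<J} pʲλⱼ + pᴶ f_J(n) + O((p,t)^{n+J+1})`, and the `p`-adic limit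
`L = Σ pʲ λⱼ`. Also the membership forms `exists_lim_of_forall_sub_mem` (limits of sequences with
`f(n+1) − f(n) ∈ Iⁿ`) and `sub_mem_of_forall_sub_mem` (telescoping along an antitone family of ideals).
(Compare Stacks Project, Tag 090T, for completeness with respect to finitely generated ideals.)

## References
* The Stacks Project, Tag 090T (completion with respect to a finitely generated ideal). [StacksProject]
* J.-M. Fontaine, *Le corps des périodes p-adiques*, Astérisque 223 (1994), Exp. II §1.3 (the
  `(p, [ϖ])`-adic topology of `A_inf`). [FontaineAsterisque223III]
-/

namespace Literature.RingTheory.AdicTopology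

namespace AdicPair

variable {A : Type*} [CommRing A] (p t : A)

/-- `pⁱ tʲ a ∈ (p, t)^{i+j}`. [cite: StacksProject, Tag 0317] -/
theorem pow_mul_pow_mul_mem (i j : ℕ) (a : A) :
    p ^ i * t ^ j * a ∈ Ideal.span {p, t} ^ (i + j) := by
  refine Ideal.mul_mem_right _ _ ?_
  rw [pow_add]
  exact Ideal.mul_mem_mul (Ideal.pow_mem_pow (Ideal.subset_span (by simp)) i)
    (Ideal.pow_mem_pow (Ideal.subset_span (by simp)) j)

/-- `p a ∈ (p, t)^{n+1}` for `a ∈ (p,t)^n`. [cite: StacksProject, Tag 0317] -/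
theorem mul_mem_pow_succ {n : ℕ} {a : A} (ha : a ∈ Ideal.span {p, t} ^ n) :
    p * a ∈ Ideal.span {p, t} ^ (n + 1) := by
  rw [pow_succ']
  exact Ideal.mul_mem_mul (Ideal.subset_span (by simp)) ha

/-- `t^{n} a ∈ (p, t)^{n}`. [cite: StacksProject, Tag 0317] -/
theorem pow_mul_mem_pow (n : ℕ) (a : A) : t ^ n * a ∈ Ideal.span {p, t} ^ n := by
  simpa using pow_mul_pow_mul_mem p t 0 n a

/-- `p^{n} a ∈ (p, t)^{n}`. [cite: StacksProject, Tag 0317] -/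
theorem pow_mul_mem_pow' (n : ℕ) (a : A) : p ^ n * a ∈ Ideal.span {p, t} ^ n := by
  simpa using pow_mul_pow_mul_mem p t n 0 a

/-- **The filtration identity** `(p,t)^{n+1} ⊆ p·(p,t)^n + t^{n+1}A` (the `(p,t)`-adic topology is defined by
the ideals `pⁿA + tⁿA`). [cite: StacksProject, Tag 0317] -/
theorem pow_succ_le (n : ℕ) :
    Ideal.span {p, t} ^ (n + 1) ≤ Ideal.span {p} * Ideal.span {p, t} ^ n ⊔ Ideal.span {t ^ (n + 1)} := by
  induction n with
  | zero =>
    rw [zero_add, pow_one, pow_zero, mul_one, pow_one, Ideal.span_insert]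
  | succ n ih =>
    have ht : Ideal.span {t ^ (n + 1)} ≤ Ideal.span {p, t} ^ (n + 1) := by
      rw [Ideal.span_singleton_le_iff_mem]
      simpa using pow_mul_mem_pow p t (n + 1) 1
    calc Ideal.span {p, t} ^ (n + 1 + 1)
        = Ideal.span {p, t} * Ideal.span {p, t} ^ (n + 1) := pow_succ' _ _
      _ ≤ Ideal.span {p, t} * (Ideal.span {p} * Ideal.span {p, t} ^ n ⊔ Ideal.span {t ^ (n + 1)}) :=
          Ideal.mul_mono_right ih
      _ = Ideal.span {p} * (Ideal.span {p, t} * Ideal.span {p, t} ^ n) ⊔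
            (Ideal.span {p} * Ideal.span {t ^ (n + 1)} ⊔ Ideal.span {t} * Ideal.span {t ^ (n + 1)}) := by
          rw [Submodule.mul_sup, ← mul_assoc, mul_comm (Ideal.span {p, t}) (Ideal.span {p}), mul_assoc]
          congr 1
          conv_lhs => rw [Ideal.span_insert, Submodule.sup_mul]
      _ ≤ Ideal.span {p} * Ideal.span {p, t} ^ (n + 1) ⊔ Ideal.span {t ^ (n + 1 + 1)} := by
          refine sup_le ?_ (sup_le ?_ ?_)
          · rw [← pow_succ']
            exact le_sup_left
          · exact le_sup_of_le_left (Ideal.mul_mono_right ht)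
          · rw [Ideal.span_singleton_mul_span_singleton, ← pow_succ']
            exact le_sup_right

/-- `(p,t)^{n+1} ⊆ (t^{n+1}) + (p)`. [cite: StacksProject, Tag 0317] -/
theorem pow_succ_le_sup (n : ℕ) :
    Ideal.span {p, t} ^ (n + 1) ≤ Ideal.span {t ^ (n + 1)} ⊔ Ideal.span {p} :=
  (pow_succ_le p t n).trans (sup_le (le_sup_of_le_right Ideal.mul_le_right) le_sup_left)

/-- Membership form of the filtration identity: `x ∈ (p,t)^{n+1} ⇒ x = p y + t^{n+1} c` with
`y ∈ (p,t)^n`. [cite: StacksProject, Tag 0317] -/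
theorem exists_eq_of_mem_pow_succ {n : ℕ} {x : A} (hx : x ∈ Ideal.span {p, t} ^ (n + 1)) :
    ∃ y ∈ Ideal.span {p, t} ^ n, ∃ c : A, x = p * y + t ^ (n + 1) * c := by
  obtain ⟨a, ha, b, hb, rfl⟩ := Submodule.mem_sup.1 (pow_succ_le p t n hx)
  obtain ⟨y, hy, rfl⟩ := Ideal.mem_span_singleton_mul.1 ha
  obtain ⟨c, rfl⟩ := Ideal.mem_span_singleton'.1 hb
  exact ⟨y, hy, c, by ring⟩

variable {p t}

/-- `t^k x ∈ (p) ⇒ x ∈ (p)` when `t` is a non-zero-divisor modulo `p`. [cite: StacksProject, Tag 0DYC] -/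
theorem mem_span_of_pow_mul_mem (htreg : ∀ x : A, t * x ∈ Ideal.span {p} → x ∈ Ideal.span {p}) :
    ∀ (k : ℕ) {x : A}, t ^ k * x ∈ Ideal.span {p} → x ∈ Ideal.span {p}
  | 0, x, h => by simpa using h
  | k + 1, x, h => by
    rw [pow_succ, mul_assoc] at h
    exact htreg _ (mem_span_of_pow_mul_mem htreg k h)

/-- **Division lemma**: `p y ∈ (p,t)^{n+1} ⇒ y ∈ (p,t)^n` (`p` a non-zero-divisor, `t` a non-zero-divisor
modulo `p`) — the torsion-freeness input replacing the Noetherian hypothesis of Stacks 0DYC. [cite: StacksProject, Tag 0DYC] -/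
theorem mem_pow_of_mul_mem_pow_succ (hpreg : ∀ x : A, p * x = 0 → x = 0)
    (htreg : ∀ x : A, t * x ∈ Ideal.span {p} → x ∈ Ideal.span {p}) {n : ℕ} {y : A}
    (h : p * y ∈ Ideal.span {p, t} ^ (n + 1)) : y ∈ Ideal.span {p, t} ^ n := by
  obtain ⟨z, hz, c, hc⟩ := exists_eq_of_mem_pow_succ p t h
  -- `t^{n+1} c = p (y - z) ∈ (p)`, so `c = p c'`
  have hc' : t ^ (n + 1) * c ∈ Ideal.span {p} :=
    Ideal.mem_span_singleton'.2 ⟨y - z, by rw [mul_comm, mul_sub, hc]; ring⟩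
  obtain ⟨c', hc''⟩ := Ideal.mem_span_singleton'.1 (mem_span_of_pow_mul_mem htreg (n + 1) hc')
  have hy : y = z + t ^ (n + 1) * c' := by
    refine sub_eq_zero.1 (hpreg _ ?_)
    rw [mul_sub, hc, ← hc'']; ring
  rw [hy]
  exact Submodule.add_mem _ hz (Ideal.pow_le_pow_right (Nat.le_succ n) (pow_mul_mem_pow p t (n + 1) c'))

/-- Telescoping along an antitone family of ideals (Cauchy sequences for an adic topology). [cite: StacksProject, Tag 0317] -/
theorem sub_mem_of_forall_sub_mem {J : ℕ → Ideal A} (hJ : Antitone J) (g : ℕ → A)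
    (hg : ∀ n, g (n + 1) - g n ∈ J n) {m n : ℕ} (h : m ≤ n) : g n - g m ∈ J m := by
  induction n, h using Nat.le_induction with
  | base => simp
  | succ n hmn ih =>
    have : g (n + 1) - g m = (g (n + 1) - g n) + (g n - g m) := by ring
    rw [this]
    exact Submodule.add_mem _ (hJ hmn (hg n)) ih

/-- **Separatedness**: `A` is `(p,t)`-adically separated if it is `p`-adically separated, `p` is a
non-zero-divisor, `t` is a non-zero-divisor mod `p`, and `A/p` is `t`-adically separated (separatedness half
of the non-Noetherian principal-pair variant of Stacks 0DYC). [cite: StacksProject, Tag 0DYC] -/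
theorem isHausdorff [IsHausdorff (Ideal.span {p}) A] (hpreg : ∀ x : A, p * x = 0 → x = 0)
    (htreg : ∀ x : A, t * x ∈ Ideal.span {p} → x ∈ Ideal.span {p})
    (hH : ∀ x : A, (∀ n : ℕ, x ∈ Ideal.span {t ^ n} ⊔ Ideal.span {p}) → x ∈ Ideal.span {p}) :
    IsHausdorff (Ideal.span {p, t}) A := by
  -- `⋂ (p,t)^n ⊆ (p^k)` for every `k`
  have key : ∀ (k : ℕ) (x : A), (∀ n, x ∈ Ideal.span {p, t} ^ n) → x ∈ Ideal.span {p ^ k} := by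
    intro k
    induction k with
    | zero => intro x _; simp
    | succ k ih =>
      intro x hx
      have hxp : x ∈ Ideal.span {p} := by
        refine hH x fun n => ?_
        rcases Nat.eq_zero_or_pos n with rfl | hn
        · simp
        · obtain ⟨m, rfl⟩ := Nat.exists_eq_add_of_le' hn
          exact pow_succ_le_sup p t m (hx (m + 1))
      obtain ⟨x₁, rfl⟩ := Ideal.mem_span_singleton'.1 hxp
      have hx₁ : ∀ n, x₁ ∈ Ideal.span {p, t} ^ n := fun n => by
        have h := hx (n + 1)
        rw [mul_comm] at h
        exact mem_pow_of_mul_mem_pow_succ hpreg htreg h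
      obtain ⟨e, he⟩ := Ideal.mem_span_singleton'.1 (ih x₁ hx₁)
      exact Ideal.mem_span_singleton'.2 ⟨e, by rw [← he]; ring⟩
  refine ⟨fun x hx => IsHausdorff.haus ‹IsHausdorff (Ideal.span {p}) A› x fun n => ?_⟩
  have hx' : ∀ n, x ∈ Ideal.span {p, t} ^ n := fun n => by
    have h := hx n
    rwa [smul_eq_mul, Ideal.mul_top, SModEq.zero] at h
  rw [smul_eq_mul, Ideal.mul_top, SModEq.zero, Ideal.span_singleton_pow]
  exact key n x hx'

/-- One **peeling step** of the completeness proof: a `(p,t)`-Cauchy sequence `f` (`f(n+1) − f(n) ∈ (p,t)^{n+1}`)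
is `λ + t^{n+2}c_{n+1} + p·g(n)` at index `n+1` with `g` again `(p,t)`-Cauchy, granted that `A/p` is
`t`-adically complete (hypothesis `hC`, phrased in `A`). [cite: StacksProject, Tag 0DYC] -/
theorem exists_peel (hpreg : ∀ x : A, p * x = 0 → x = 0)
    (htreg : ∀ x : A, t * x ∈ Ideal.span {p} → x ∈ Ideal.span {p})
    (hC : ∀ f : ℕ → A, (∀ n, f (n + 1) - f n ∈ Ideal.span {t ^ (n + 1)} ⊔ Ideal.span {p}) →
      ∃ l : A, ∀ n, l - f n ∈ Ideal.span {t ^ (n + 1)} ⊔ Ideal.span {p})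
    (f : ℕ → A) (hf : ∀ n, f (n + 1) - f n ∈ Ideal.span {p, t} ^ (n + 1)) :
    ∃ l : A, ∃ g : ℕ → A, (∀ n, g (n + 1) - g n ∈ Ideal.span {p, t} ^ (n + 1)) ∧
      ∀ n, f (n + 1) - l - p * g n ∈ Ideal.span {p, t} ^ (n + 2) := by
  obtain ⟨l, hl⟩ := hC f fun n => pow_succ_le_sup p t n (hf n)
  -- `f n - l = t^{n+1} c n + p g₀ n`
  have hdec : ∀ n, ∃ c g₀ : A, f n - l = t ^ (n + 1) * c + p * g₀ := by
    intro n
    obtain ⟨a, ha, b, hb, hab⟩ := Submodule.mem_sup.1 (Submodule.neg_mem _ (hl n))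
    obtain ⟨c, rfl⟩ := Ideal.mem_span_singleton'.1 ha
    obtain ⟨g₀, rfl⟩ := Ideal.mem_span_singleton'.1 hb
    exact ⟨c, g₀, by rw [← neg_sub, ← hab]; ring⟩
  choose c g₀ hcg using hdec
  refine ⟨l, fun n => g₀ (n + 1), fun n => ?_, fun n => ?_⟩
  · -- `p (g₀(n+2) − g₀(n+1)) ∈ (p,t)^{n+2}`
    refine mem_pow_of_mul_mem_pow_succ hpreg htreg ?_
    have h : p * (g₀ (n + 1 + 1) - g₀ (n + 1)) =
        (f (n + 1 + 1) - f (n + 1)) - t ^ (n + 1 + 1 + 1) * c (n + 1 + 1) + t ^ (n + 1 + 1) * c (n + 1) := by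
      have h1 := hcg (n + 1 + 1); have h2 := hcg (n + 1)
      linear_combination h2 - h1
    rw [h]
    refine Submodule.add_mem _ (Submodule.sub_mem _ (hf (n + 1)) ?_) (pow_mul_mem_pow p t _ _)
    exact Ideal.pow_le_pow_right (Nat.le_succ _) (pow_mul_mem_pow p t _ _)
  · have h : f (n + 1) - l - p * g₀ (n + 1) = t ^ (n + 1 + 1) * c (n + 1) := by
      have h1 := hcg (n + 1); linear_combination h1
    rw [h]
    exact pow_mul_mem_pow p t _ _

/-- **Completeness**: `A` is `(p,t)`-adically precomplete if it is `p`-adically precomplete, `p` is a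
non-zero-divisor, `t` is a non-zero-divisor mod `p`, and `A/p` is `t`-adically complete (`hC`).
Proof: iterate `exists_peel` (`f(n+J) = s_J + p^J g_J(n) + O((p,t)^{n+J+1})`, `s_{J+1} − s_J ∈ (p^J)`) and take
the `p`-adic limit of `s_J` (completeness half of the non-Noetherian principal-pair variant of Stacks 0DYC).
[cite: StacksProject, Tag 0DYC] -/
theorem isPrecomplete [IsPrecomplete (Ideal.span {p}) A] (hpreg : ∀ x : A, p * x = 0 → x = 0)
    (htreg : ∀ x : A, t * x ∈ Ideal.span {p} → x ∈ Ideal.span {p})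
    (hC : ∀ f : ℕ → A, (∀ n, f (n + 1) - f n ∈ Ideal.span {t ^ (n + 1)} ⊔ Ideal.span {p}) →
      ∃ l : A, ∀ n, l - f n ∈ Ideal.span {t ^ (n + 1)} ⊔ Ideal.span {p}) :
    IsPrecomplete (Ideal.span {p, t}) A := by
  classical
  -- Cauchy sequences in the normalisation `g(n+1) − g(n) ∈ (p,t)^{n+1}`
  let C : Type _ := {g : ℕ → A // ∀ n, g (n + 1) - g n ∈ Ideal.span {p, t} ^ (n + 1)}
  -- one peeling step as a function
  have peel : ∀ g : C, ∃ lg : A × C, ∀ n, g.1 (n + 1) - lg.1 - p * lg.2.1 n ∈ Ideal.span {p, t} ^ (n + 2) := by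
    intro g
    obtain ⟨l, g', hg', h⟩ := exists_peel hpreg htreg hC g.1 g.2
    exact ⟨(l, ⟨g', hg'⟩), h⟩
  choose next hnext using peel
  refine ⟨fun f hf => ?_⟩
  -- re-index: `f' n = f (n+1)` satisfies the normalisation
  have hf' : ∀ n, f (n + 1 + 1) - f (n + 1) ∈ Ideal.span {p, t} ^ (n + 1) := by
    intro n
    have h := hf (Nat.le_succ (n + 1))
    rw [smul_eq_mul, Ideal.mul_top, SModEq.sub_mem] at h
    simpa using Submodule.neg_mem _ h
  let f₀ : C := ⟨fun n => f (n + 1), hf'⟩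
  -- the iteration `(s_J, g_J)`
  let it : ℕ → A × C := fun J => Nat.rec ((0 : A), f₀) (fun J sg => (sg.1 + p ^ J * (next sg.2).1, (next sg.2).2)) J
  have it_zero : it 0 = (0, f₀) := rfl
  have it_succ : ∀ J, it (J + 1) = ((it J).1 + p ^ J * (next (it J).2).1, (next (it J).2).2) := fun J => rfl
  -- invariant
  have inv : ∀ J n, f (n + J + 1) - (it J).1 - p ^ J * (it J).2.1 n ∈ Ideal.span {p, t} ^ (n + J + 1) := by
    intro J
    induction J with
    | zero => intro n; simp [it_zero, f₀]
    | succ J ih =>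
      intro n
      rw [it_succ]
      have h1 := ih (n + 1)
      have h2 := hnext (it J).2 n
      have h3 : p ^ J * ((it J).2.1 (n + 1) - (next (it J).2).1 - p * (next (it J).2).2.1 n) ∈
          Ideal.span {p, t} ^ (n + (J + 1) + 1) := by
        have := Ideal.mul_mem_mul (Ideal.pow_mem_pow (show p ∈ Ideal.span {p, t} from Ideal.subset_span (by simp)) J) h2
        rw [← pow_add] at this
        exact Ideal.pow_le_pow_right (by omega) this
      have h4 : f (n + (J + 1) + 1) - (it J).1 - p ^ J * (it J).2.1 (n + 1) ∈
          Ideal.span {p, t} ^ (n + (J + 1) + 1) := by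
        have e : n + 1 + J + 1 = n + (J + 1) + 1 := by ring
        rw [e] at h1
        exact h1
      have h5 : f (n + (J + 1) + 1) - ((it J).1 + p ^ J * (next (it J).2).1) - p ^ (J + 1) * (next (it J).2).2.1 n =
          (f (n + (J + 1) + 1) - (it J).1 - p ^ J * (it J).2.1 (n + 1)) +
            p ^ J * ((it J).2.1 (n + 1) - (next (it J).2).1 - p * (next (it J).2).2.1 n) := by
        ring
      rw [h5]
      exact Submodule.add_mem _ h4 h3
  -- `s_J` is `p`-adically Cauchy
  have hs : ∀ {m n : ℕ}, m ≤ n → (it m).1 ≡ (it n).1 [SMOD (Ideal.span {p} ^ m • ⊤ : Submodule A A)] := by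
    intro m n hmn
    rw [smul_eq_mul, Ideal.mul_top, Ideal.span_singleton_pow, SModEq.sub_mem]
    have h := sub_mem_of_forall_sub_mem (J := fun k => Ideal.span {p ^ k})
      (fun a b hab => Ideal.span_singleton_le_span_singleton.2 (pow_dvd_pow p hab)) (fun k => (it k).1)
      (fun k => by rw [it_succ]; exact Ideal.mem_span_singleton'.2 ⟨(next (it k).2).1, by ring⟩) hmn
    simpa using Submodule.neg_mem _ h
  obtain ⟨L, hL⟩ := IsPrecomplete.prec ‹IsPrecomplete (Ideal.span {p}) A› hs
  refine ⟨L, fun n => ?_⟩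
  rw [smul_eq_mul, Ideal.mul_top, SModEq.sub_mem]
  have hpI : Ideal.span {p} ≤ Ideal.span {p, t} := Ideal.span_mono (by simp)
  have hLn : (it n).1 - L ∈ Ideal.span {p, t} ^ n := by
    have h := hL n
    rw [smul_eq_mul, Ideal.mul_top, SModEq.sub_mem] at h
    exact Ideal.pow_right_mono hpI n h
  have hfn : f n - f (n + 1) ∈ Ideal.span {p, t} ^ n := by
    have h := hf (Nat.le_succ n)
    rwa [smul_eq_mul, Ideal.mul_top, SModEq.sub_mem] at h
  have hinv := inv n 0
  rw [zero_add] at hinv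
  have hdecomp : f n - L = (f n - f (n + 1)) + (f (n + 1) - (it n).1 - p ^ n * (it n).2.1 0) +
      ((it n).1 - L) + p ^ n * (it n).2.1 0 := by ring
  rw [hdecomp]
  exact Submodule.add_mem _ (Submodule.add_mem _ (Submodule.add_mem _ hfn
    (Ideal.pow_le_pow_right (Nat.le_succ n) hinv)) hLn) (pow_mul_mem_pow' p t n _)

/-- **Two-generator completeness criterion.** Let `p, t ∈ A` with `A` `p`-adically complete and
separated, `p` a non-zero-divisor, `t` a non-zero-divisor modulo `p`, and `A/p` `t`-adically complete and
separated (hypotheses `hH`, `hC` phrased in `A` modulo `(p)`). Then `A` is `(p, t)`-adically complete and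
separated. This is the principal-pair, non-Noetherian variant of Stacks Lemma 10.97.10 (Tag 0DYC: `A`
Noetherian, `I`-adically complete, `A/I` `J`-adically complete ⇒ complete), with Noetherianity replaced by the
torsion-freeness hypotheses (ii)–(iii). [cite: StacksProject, Tag 0DYC] -/
theorem isAdicComplete [IsAdicComplete (Ideal.span {p}) A] (hpreg : ∀ x : A, p * x = 0 → x = 0)
    (htreg : ∀ x : A, t * x ∈ Ideal.span {p} → x ∈ Ideal.span {p})
    (hH : ∀ x : A, (∀ n : ℕ, x ∈ Ideal.span {t ^ n} ⊔ Ideal.span {p}) → x ∈ Ideal.span {p})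
    (hC : ∀ f : ℕ → A, (∀ n, f (n + 1) - f n ∈ Ideal.span {t ^ (n + 1)} ⊔ Ideal.span {p}) →
      ∃ l : A, ∀ n, l - f n ∈ Ideal.span {t ^ (n + 1)} ⊔ Ideal.span {p}) :
    IsAdicComplete (Ideal.span {p, t}) A :=
  have := isHausdorff hpreg htreg hH
  have := isPrecomplete hpreg htreg hC
  ⟨⟩

/-- Membership form of completeness: a sequence with `f(n+1) − f(n) ∈ Iⁿ` has a limit `L` with
`L − f(n) ∈ Iⁿ`, in any `I`-adically precomplete module. [cite: StacksProject, Tag 0317] -/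
theorem exists_lim_of_forall_sub_mem {I : Ideal A} [IsPrecomplete I A] (f : ℕ → A)
    (hf : ∀ n, f (n + 1) - f n ∈ I ^ n) : ∃ L : A, ∀ n, L - f n ∈ I ^ n := by
  have hc : ∀ {m n : ℕ}, m ≤ n → f m ≡ f n [SMOD (I ^ m • ⊤ : Submodule A A)] := by
    intro m n hmn
    rw [smul_eq_mul, Ideal.mul_top, SModEq.sub_mem]
    have h := sub_mem_of_forall_sub_mem (J := fun k => I ^ k) (fun a b hab => Ideal.pow_le_pow_right hab) f hf hmn
    simpa using Submodule.neg_mem _ h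
  obtain ⟨L, hL⟩ := IsPrecomplete.prec ‹IsPrecomplete I A› hc
  refine ⟨L, fun n => ?_⟩
  have h := hL n
  rw [smul_eq_mul, Ideal.mul_top, SModEq.sub_mem] at h
  simpa using Submodule.neg_mem _ h

end AdicPair

end Literature.RingTheory.AdicTopology
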